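import Summits.QuantumFields.BalabanUV.Beta.GAN24.BackgroundExpansionAllOrders
import Summits.QuantumFields.BalabanUV.Beta.GAN24.EffectiveFormInsertionLaw
import Mathlib.Analysis.Calculus.FDeriv.Mul
import Mathlib.Analysis.Calculus.Deriv.Mul
import Mathlib.Analysis.Calculus.Deriv.Add
import Mathlib.Analysis.Calculus.Deriv.Comp
import Mathlib.Analysis.Calculus.IteratedDeriv.Lemmas
import Mathlib.Analysis.Normed.Ring.Units

/-!
# `BalabanUV.Beta.GAN24.BackgroundExpansionTaylor` — binder row G-an2-4 ∕ (CONV-C), route R7 «TWO CURRENCIES», PART 161: THE DIAGRAMS ARE THE DERIVATIVES.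
# For ANY square matrices `D, P`, ANY linear read-out `Φ` and the resolvent line `u ↦ R(u) = (D + uP)⁻¹`: `R′ = −RPR`, `(R(PR)^j)′ = −(j+1)·R(PR)^{j+1}`, `(Φ(R)⁻¹)′ = Φ(R)⁻¹·Φ(RPR)·Φ(R)⁻¹`;
# hence (product rule over a `List`) the derivative of every DIAGRAM — a finite product of the letters `Φ(R(u))⁻¹` and `Φ(R(u)(PR(u))^j)` — is a finite `ℤ`-combination of diagrams,
# and for every order `N` there is ONE finite `ℤ`-combination of diagrams, THE SAME FOR ALL `(D, P, Φ)`, equal to `∂^N_u[Φ(R(u))⁻¹]` wherever `D + uP` and `Φ(R(u))` are invertible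
# (Faà di Bruno for the inverse of a resolvent read-out, by induction on `N`; §1–§2, GENERIC).  §3 reads it on the first-order model: `D = Δ_a^{(k)}`, `P = P(V_t)^{(k)}`, `Φ = L^{dk}Q_k(·)Q_kᴴ`
# at level `k`, so `Φ(R(u)) = c_k(u)` and at `u = 0` the letters are `c_k⁻¹` and the insertion chains `X^{(j)}_k` (PART 156 ∕ 159) — by PART 160 (`conv_diagramSum_of_tendsto_background`)
# EVERY u-DERIVATIVE `∂^N_u(c_k(u)⁻¹)|_{u=0}` (`N ≥ 0`; `= ∂^N_uΣ_k(u)|₀` for `N ≥ 1`, `Σ_k(u) = c_k(u)⁻¹ − a″1`) of the effective form WITH background, as a volume family, has the β-cell's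
# whole `LimitRate` END on `ℤ^d` MODULO ONLY the background's pointwise limit: PARTs 147 (`N = 1`) and 157 (`N = 2`) are the first two instances (unit b2b-balaban-gan24-p3, gen 56; v1)

NOT IN PRINT; OUR PROOF ([folklore] matrix calculus — Mathlib's `hasFDerivAt_ringInverse` on the complete normed algebra `Matrix m m ℂ` with the scoped `ℓ²`-operator norm (the pattern of
PART 12 `DerivativeRateTransferAnalyticKKT.hasDerivAt_matrix_inv`, there with the `L∞` operator norm), `HasDerivAt.mul ∕ const_smul ∕ fun_sum`, `iteratedDeriv_succ`,
`Filter.EventuallyEq.deriv_eq`; PART 160 (`conv_diagramSum_of_tendsto_background`), PART 118 (`isUnit_det_unitCovB_and_opNorm_inv_le`), NE2's `isUnit_det_calDalev`; [Balaban1987RG1]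
(1.21)–(1.22) p. 264 LOCATE the shapes; nothing printed is a hypothesis).
HONEST FRAMING (cell contract, verbatim): «discharging `BetaPertH` makes Bałaban's UV stability UNCONDITIONAL — a real constructive-QFT result; it is NOT the
continuum limit and NOT the Clay problem.»  HONEST DEPENDENCY (verbatim): «continuum YM on T⁴ ⇐ BetaPertH ∧ nine spine estimates (0/9 proved); BetaPertH ⇐
(D1) ∧ (D4) ∧ CAP+tail; G-an2-4 gates asym, D1 and NE2/3/4.»

WHAT THIS FILE PROVES (0 sorry, 0 `def`; `R(u) = (D + u•P)⁻¹`; the LETTER of `o : Option ℕ` at `u` is `o.elim (Φ R(u))⁻¹ (j ↦ Φ(R(u)(PR(u))^j))`, the DIAGRAM of `ℓ : List (Option ℕ)` is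
`(ℓ.map letter).prod`; complex matrices, scoped `ℓ²`-operator norm):
* §1 (GENERIC) `hasDerivAt_nonsing_inv` (`(A⁻¹)′ = −A⁻¹A′A⁻¹`), `hasDerivAt_resolvent` (`R′ = −RPR`), `hasDerivAt_chainPow` (`(R(PR)^j)′ = −(j+1)•R(PR)^{j+1}`), `hasDerivAt_letter_some`,
  `hasDerivAt_letter_none` (`((ΦR)⁻¹)′ = (ΦR)⁻¹Φ(R(PR)^1)(ΦR)⁻¹`), `isOpen_resolventSet`.
* §2 (GENERIC) **`hasDerivAt_diagram`** (every diagram `ℓ`: `∃` a finite `ℤ`-combination of diagrams, uniform in `(D, P, Φ, u)`, that is its derivative), **`iteratedDeriv_inv_eq_diagramSum`**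
  (every `N`: `∃ (J, z, ℓ)` finite, uniform in the data, with `∂^N_u[(ΦR(u))⁻¹] = Σ_{i ∈ J} z_i • diagram(ℓ_i)(u)` at every `u` with `D + uP`, `ΦR(u)` invertible).
* §3 (`d ≥ 3`, `L ≥ 2`, `a > 0`, `μ ≠ ν`, even cubic volumes `2(t+1)`; ONE volume-indexed family of Lipschitz backgrounds `V_t` with `(α, β)` uniform, DISPLAYING ONLY EL₁)
  `chainPow_eq_word` (`𝒢(P𝒢)^j = foldr (𝒢P·) 𝒢 (replicate j ⋆)`), `exists_clm_avgTow`, **`conv_iteratedDeriv_invPertCov_of_tendsto_background`**: for EVERY `N`, the tower family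
  `(t, k) ↦ ∂^N_u[(c_k(u))⁻¹]|_{u=0}`, `c_k(u) = L^{dk}Q_k(Δ_a^{(k)} + uP(V_t)^{(k)})⁻¹Q_kᴴ`, has `∃ κ > 0, B, B′ ≥ 0, Π` with `IsInfiniteVolumeLimit`, `UniformDecay Π μ ν B (κ∕d)`,
  `StepRate Π μ ν B′ (κ∕d) (√(L⁻¹))`, `KernelInputs d Π`, `∀ k, |secondMoment (Π k) μ ν − secondMoment (limKernelOf Π) μ ν| ≤ β′_d(B′∕(1−√(L⁻¹)), κ∕d)·(√(L⁻¹))^k`; and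
  **`conv_iteratedDeriv_effFormPert_of_tendsto_background`** — the same for `∂^N_uΣ_k(u)|₀`, `N ≥ 1`.
WHAT IT DOES NOT DO: base points `u₀ ≠ 0` (the identity of §2 holds there verbatim; the END needs the INPUT triple of the letters at `u₀` — follower); several background directions at once
(polarisation of §2 along `Σ_i s_iV_i`, or the word version of §2); `d ≤ 2` ∕ odd volumes; Bałaban's `Π⁰_{k+1}` ∕ `U_k` (row an1's dictionary).  SUPPLIER work; NEVER «G-an2-4 closed»;
NOT (CONV-C), NOT D1, NOT `BetaPertH`, NOT continuum, NOT Clay.  Records: `HOME/b2b-balaban-gan24-p3/gen56/README.md`.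
-/

noncomputable section

open scoped BigOperators ComplexConjugate Matrix Matrix.Norms.L2Operator
open Filter Topology

namespace Summit.QuantumFields.BalabanUV.Beta.GAN24.BackgroundExpansionTaylor

/-! ## §1 Generic: the resolvent line, its chains, the two letters -/

section Calculus

variable {m n : Type*} [Fintype m] [DecidableEq m] [Fintype n] [DecidableEq n]

/-- **`(A⁻¹)′ = −A⁻¹·A′·A⁻¹`** along a `ℂ`-line of matrices at a point where `det A` is a unit (Mathlib's `hasFDerivAt_ringInverse` on the complete normed algebra `Matrix n n ℂ` with the
`ℓ²`-operator norm; `Matrix.nonsing_inv_eq_ringInverse`; PART 12's lemma in this norm). [folklore] -/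
theorem hasDerivAt_nonsing_inv {A : ℂ → Matrix n n ℂ} {A' : Matrix n n ℂ} {u : ℂ} (h : HasDerivAt A A' u) (hdet : IsUnit (A u).det) :
    HasDerivAt (fun v => (A v)⁻¹) (-((A u)⁻¹ * A' * (A u)⁻¹)) u := by
  haveI : CompleteSpace (Matrix n n ℂ) := FiniteDimensional.complete ℂ (Matrix n n ℂ)
  obtain ⟨w, hw⟩ := (Matrix.isUnit_iff_isUnit_det _).2 hdet
  have key := hasFDerivAt_ringInverse (𝕜 := ℂ) w
  rw [hw] at key
  have h2 := key.comp_hasDerivAt u h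
  simp only [neg_apply, ContinuousLinearMap.mulLeftRight_apply] at h2
  have hinv : ((w⁻¹ : (Matrix n n ℂ)ˣ) : Matrix n n ℂ) = (A u)⁻¹ := by
    rw [Matrix.coe_units_inv, hw]
  rw [hinv] at h2
  refine h2.congr_of_eventuallyEq (Eventually.of_forall fun v => ?_)
  exact Matrix.nonsing_inv_eq_ringInverse (A v)

/-- **`R′ = −RPR`** for the resolvent line `R(u) = (D + u•P)⁻¹` at a point where `D + uP` is invertible. [folklore] -/
theorem hasDerivAt_resolvent (D P : Matrix m m ℂ) {u : ℂ} (hu : IsUnit (D + u • P).det) :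
    HasDerivAt (fun v : ℂ => (D + v • P)⁻¹) (-((D + u • P)⁻¹ * P * (D + u • P)⁻¹)) u := by
  have hA : HasDerivAt (fun v : ℂ => D + v • P) P u := by
    have h := ((hasDerivAt_id u).smul_const P).const_add D
    simpa using h
  exact hasDerivAt_nonsing_inv hA hu

/-- **`(R(PR)^j)′ = −(j+1)•R(PR)^{j+1}`** (each of the `j+1` factors `R` differentiates to `−RPR`). [folklore] -/
theorem hasDerivAt_chainPow (D P : Matrix m m ℂ) {u : ℂ} (hu : IsUnit (D + u • P).det) (j : ℕ) :
    HasDerivAt (fun v : ℂ => (D + v • P)⁻¹ * (P * (D + v • P)⁻¹) ^ j) (-(((j : ℂ) + 1) • ((D + u • P)⁻¹ * (P * (D + u • P)⁻¹) ^ (j + 1)))) u := by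
  induction j with
  | zero =>
    have h := hasDerivAt_resolvent D P hu
    refine (h.congr_of_eventuallyEq (Eventually.of_forall fun v => ?_)).congr_deriv ?_
    · simp only [pow_zero, Matrix.mul_one]
    · simp only [Nat.cast_zero, zero_add, one_smul, pow_one, Matrix.mul_assoc]
  | succ j ih =>
    have hPR : HasDerivAt (fun v : ℂ => P * (D + v • P)⁻¹) (P * -((D + u • P)⁻¹ * P * (D + u • P)⁻¹)) u := (hasDerivAt_resolvent D P hu).const_mul P
    have h := ih.fun_mul hPR
    refine (h.congr_of_eventuallyEq (Eventually.of_forall fun v => ?_)).congr_deriv ?_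
    · show (D + v • P)⁻¹ * (P * (D + v • P)⁻¹) ^ (j + 1) = (D + v • P)⁻¹ * (P * (D + v • P)⁻¹) ^ j * (P * (D + v • P)⁻¹)
      rw [pow_succ, Matrix.mul_assoc]
    · set R : Matrix m m ℂ := (D + u • P)⁻¹
      have e1 : -(((j : ℂ) + 1) • (R * (P * R) ^ (j + 1))) * (P * R) = -(((j : ℂ) + 1) • (R * (P * R) ^ (j + 1 + 1))) := by
        rw [Matrix.neg_mul, Matrix.smul_mul, Matrix.mul_assoc, ← pow_succ]
      have e2 : R * (P * R) ^ j * (P * -(R * P * R)) = -(R * (P * R) ^ (j + 1 + 1)) := by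
        simp only [Matrix.mul_neg, pow_succ, Matrix.mul_assoc]
      have e3 : -((((j + 1 : ℕ) : ℂ) + 1) • (R * (P * R) ^ (j + 1 + 1))) = -(((j : ℂ) + 1) • (R * (P * R) ^ (j + 1 + 1))) + -(R * (P * R) ^ (j + 1 + 1)) := by
        rw [Nat.cast_succ, add_smul, one_smul, neg_add]
      rw [e1, e2, e3]

/-- the letter `u ↦ Φ(R(u)(PR(u))^j)`: derivative `−(j+1)•Φ(R(PR)^{j+1})` (`Φ` a continuous linear read-out). [folklore] -/
theorem hasDerivAt_letter_some (D P : Matrix m m ℂ) (Φ : Matrix m m ℂ →L[ℂ] Matrix n n ℂ) {u : ℂ} (hu : IsUnit (D + u • P).det) (j : ℕ) :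
    HasDerivAt (fun v : ℂ => Φ ((D + v • P)⁻¹ * (P * (D + v • P)⁻¹) ^ j)) (-(((j : ℂ) + 1) • Φ ((D + u • P)⁻¹ * (P * (D + u • P)⁻¹) ^ (j + 1)))) u := by
  have h := (Φ.hasFDerivAt).comp_hasDerivAt u (hasDerivAt_chainPow D P hu j)
  refine h.congr_deriv ?_
  rw [map_neg, map_smul]

/-- the letter `u ↦ (ΦR(u))⁻¹`: derivative `(ΦR)⁻¹·Φ(R(PR)^1)·(ΦR)⁻¹` (`= c⁻¹ċc⁻¹` up to the sign convention `ċ = −Φ(RPR)`). [folklore] -/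
theorem hasDerivAt_letter_none (D P : Matrix m m ℂ) (Φ : Matrix m m ℂ →L[ℂ] Matrix n n ℂ) {u : ℂ} (hu : IsUnit (D + u • P).det)
    (hc : IsUnit (Φ (D + u • P)⁻¹).det) :
    HasDerivAt (fun v : ℂ => (Φ (D + v • P)⁻¹)⁻¹)
      ((Φ (D + u • P)⁻¹)⁻¹ * Φ ((D + u • P)⁻¹ * (P * (D + u • P)⁻¹) ^ 1) * (Φ (D + u • P)⁻¹)⁻¹) u := by
  have h0 := hasDerivAt_letter_some D P Φ hu 0
  have h1 : HasDerivAt (fun v : ℂ => Φ (D + v • P)⁻¹) (-(Φ ((D + u • P)⁻¹ * (P * (D + u • P)⁻¹) ^ 1))) u := by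
    refine (h0.congr_of_eventuallyEq (Eventually.of_forall fun v => ?_)).congr_deriv ?_
    · simp only [pow_zero, Matrix.mul_one]
    · simp only [Nat.cast_zero, zero_add, one_smul]
  have h2 := hasDerivAt_nonsing_inv h1 hc
  refine h2.congr_deriv ?_
  rw [Matrix.mul_neg, Matrix.neg_mul, neg_neg]

omit [DecidableEq n] in
/-- continuity ⟹ the set of GOOD couplings `{u | det(D + uP) ≠ 0 ∧ det Φ(R(u)) ≠ 0}` is open (the second condition is read only where the first holds; `R` is differentiable there).
[folklore] -/
theorem isOpen_resolventSet [DecidableEq n] (D P : Matrix m m ℂ) (Φ : Matrix m m ℂ →L[ℂ] Matrix n n ℂ) :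
    IsOpen {u : ℂ | IsUnit (D + u • P).det ∧ IsUnit (Φ (D + u • P)⁻¹).det} := by
  rw [isOpen_iff_mem_nhds]
  rintro u ⟨hu, hc⟩
  have h1 : ∀ᶠ v in 𝓝 u, IsUnit (D + v • P).det := by
    have hcont : Continuous fun v : ℂ => (D + v • P).det := (continuous_const.add (continuous_id.smul continuous_const)).matrix_det
    have hne : (D + u • P).det ≠ 0 := hu.ne_zero
    exact (hcont.continuousAt.eventually_ne hne).mono fun v hv => isUnit_iff_ne_zero.mpr hv
  have h2 : ∀ᶠ v in 𝓝 u, IsUnit (Φ (D + v • P)⁻¹).det := by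
    have hcont : ContinuousAt (fun v : ℂ => (Φ (D + v • P)⁻¹).det) u := by
      have hd : HasDerivAt (fun v : ℂ => Φ (D + v • P)⁻¹) (Φ (-((D + u • P)⁻¹ * P * (D + u • P)⁻¹))) u :=
        (Φ.hasFDerivAt).comp_hasDerivAt u (hasDerivAt_resolvent D P hu)
      exact (continuous_id.matrix_det.continuousAt).comp hd.continuousAt
    exact (hcont.eventually_ne hc.ne_zero).mono fun v hv => isUnit_iff_ne_zero.mpr hv
  exact (h1.and h2)

end Calculus

/-! ## §2 Generic: the derivative of a diagram is a finite `ℤ`-combination of diagrams; all iterated derivatives of `(ΦR)⁻¹` -/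

section Diagrams

/-- **`hasDerivAt_diagram` — THE DERIVATIVE OF EVERY DIAGRAM IS A FINITE `ℤ`-COMBINATION OF DIAGRAMS, UNIFORMLY IN THE DATA** [our proof]: for every `ℓ : List (Option ℕ)` there are a
finite index type `J`, integers `z_i` and diagrams `ℓ_i` such that for ALL square complex matrices `D, P`, ALL continuous linear read-outs `Φ` and ALL couplings `u` with `D + uP` and
`Φ(R(u))` invertible, `d∕du Π_{o ∈ ℓ} letter_o(u) = Σ_i z_i • Π_{o ∈ ℓ_i} letter_o(u)` (product rule over the list; the letter rules `((ΦR)⁻¹)′ = [none, some 1, none]`, `(some j)′ =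
−(j+1)•[some (j+1)]`). -/
theorem hasDerivAt_diagram (ℓ : List (Option ℕ)) :
    ∃ (J : Type) (_ : Fintype J) (z : J → ℤ) (ℓ' : J → List (Option ℕ)),
      ∀ {m n : Type} [Fintype m] [DecidableEq m] [Fintype n] [DecidableEq n]
        (D P : Matrix m m ℂ) (Φ : Matrix m m ℂ →L[ℂ] Matrix n n ℂ) (u : ℂ),
        IsUnit (D + u • P).det → IsUnit (Φ (D + u • P)⁻¹).det →
        HasDerivAt (fun v : ℂ => (ℓ.map fun o : Option ℕ => o.elim (Φ (D + v • P)⁻¹)⁻¹ (fun j => Φ ((D + v • P)⁻¹ * (P * (D + v • P)⁻¹) ^ j))).prod)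
          (∑ i : J, (z i : ℂ) • ((ℓ' i).map fun o : Option ℕ => o.elim (Φ (D + u • P)⁻¹)⁻¹ (fun j => Φ ((D + u • P)⁻¹ * (P * (D + u • P)⁻¹) ^ j))).prod) u := by
  induction ℓ with
  | nil =>
    refine ⟨Fin 0, inferInstance, Fin.elim0, Fin.elim0, ?_⟩
    intro m n _ _ _ _ D P Φ u hu hc
    simp only [List.map_nil, List.prod_nil, Finset.univ_eq_empty, Finset.sum_empty]
    exact hasDerivAt_const u 1
  | cons o ℓ ih =>
    obtain ⟨J, hJ, z, ℓ', h⟩ := ih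
    cases o with
    | none =>
      refine ⟨Option J, inferInstance, fun i => i.elim 1 z, fun i => i.elim ([none, some 1, none] ++ ℓ) (fun i' => none :: ℓ' i'), ?_⟩
      intro m n _ _ _ _ D P Φ u hu hc
      have hd := (hasDerivAt_letter_none D P Φ hu hc).fun_mul (h D P Φ u hu hc)
      simp only [List.map_cons, List.prod_cons]
      refine hd.congr_deriv ?_
      rw [Fintype.sum_option]
      simp only [Option.elim, Int.cast_one, one_smul, List.map_append, List.prod_append, List.map_cons, List.prod_cons, List.map_nil, List.prod_nil,
        Matrix.mul_one, Finset.mul_sum, Matrix.mul_smul, Matrix.mul_assoc]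
    | some j =>
      refine ⟨Option J, inferInstance, fun i => i.elim (-((j : ℤ) + 1)) z, fun i => i.elim (some (j + 1) :: ℓ) (fun i' => some j :: ℓ' i'), ?_⟩
      intro m n _ _ _ _ D P Φ u hu hc
      have hd := (hasDerivAt_letter_some D P Φ hu j).fun_mul (h D P Φ u hu hc)
      simp only [List.map_cons, List.prod_cons]
      refine hd.congr_deriv ?_
      rw [Fintype.sum_option]
      simp only [Option.elim, Int.cast_neg, Int.cast_add, Int.cast_natCast, Int.cast_one, List.map_cons, List.prod_cons, Finset.mul_sum, Matrix.mul_smul,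
        Matrix.neg_mul, Matrix.smul_mul, neg_smul]

/-- **`iteratedDeriv_inv_eq_diagramSum` — FAÀ DI BRUNO FOR THE INVERSE OF A RESOLVENT READ-OUT, ALL ORDERS, UNIFORMLY** [our proof]: for every `N` there are a finite index type `J`,
integers `z_i` and diagrams `ℓ_i ∈ List (Option ℕ)` such that for ALL square complex matrices `D, P`, ALL continuous linear read-outs `Φ` and ALL couplings `u` with `D + uP` and
`Φ(R(u))` invertible, `∂^N_u[(Φ(D + uP)⁻¹)⁻¹] = Σ_{i ∈ J} z_i • Π_{o ∈ ℓ_i} letter_o(u)` (letters `none ↦ (ΦR(u))⁻¹`, `some j ↦ Φ(R(u)(PR(u))^j)`).  Induction on `N`: the good set is open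
(`isOpen_resolventSet`), so the order-`N` identity holds near `u` and may be differentiated (`Filter.EventuallyEq.deriv_eq`, `hasDerivAt_diagram`, `iteratedDeriv_succ`). -/
theorem iteratedDeriv_inv_eq_diagramSum (N : ℕ) :
    ∃ (J : Type) (_ : Fintype J) (z : J → ℤ) (ℓ : J → List (Option ℕ)),
      ∀ {m n : Type} [Fintype m] [DecidableEq m] [Fintype n] [DecidableEq n]
        (D P : Matrix m m ℂ) (Φ : Matrix m m ℂ →L[ℂ] Matrix n n ℂ) (u : ℂ),
        IsUnit (D + u • P).det → IsUnit (Φ (D + u • P)⁻¹).det →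
        iteratedDeriv N (fun v : ℂ => (Φ (D + v • P)⁻¹)⁻¹) u
          = ∑ i : J, (z i : ℂ) • ((ℓ i).map fun o : Option ℕ => o.elim (Φ (D + u • P)⁻¹)⁻¹ (fun j => Φ ((D + u • P)⁻¹ * (P * (D + u • P)⁻¹) ^ j))).prod := by
  induction N with
  | zero =>
    refine ⟨Unit, inferInstance, fun _ => 1, fun _ => [none], ?_⟩
    intro m n _ _ _ _ D P Φ u hu hc
    simp only [iteratedDeriv_zero, Finset.univ_unique, Finset.sum_singleton, Int.cast_one, one_smul, List.map_cons, List.map_nil, List.prod_cons, List.prod_nil,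
      Option.elim, Matrix.mul_one]
  | succ N ih =>
    obtain ⟨J, hJ, z, ℓ, hN⟩ := ih
    choose Jf Ff zf ℓf hf using fun i : J => hasDerivAt_diagram (ℓ i)
    letI : ∀ i, Fintype (Jf i) := Ff
    refine ⟨(i : J) × Jf i, inferInstance, fun p => z p.1 * zf p.1 p.2, fun p => ℓf p.1 p.2, ?_⟩
    intro m n _ _ _ _ D P Φ u hu hc
    -- the order-`N` identity holds on the (open) good set, hence near `u`
    have hopen := isOpen_resolventSet D P Φ
    have hnhds : ∀ᶠ v in 𝓝 u, iteratedDeriv N (fun v : ℂ => (Φ (D + v • P)⁻¹)⁻¹) v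
        = ∑ i : J, (z i : ℂ) • ((ℓ i).map fun o : Option ℕ => o.elim (Φ (D + v • P)⁻¹)⁻¹ (fun j => Φ ((D + v • P)⁻¹ * (P * (D + v • P)⁻¹) ^ j))).prod :=
      Filter.eventually_of_mem (hopen.mem_nhds ⟨hu, hc⟩) fun v hv => hN D P Φ v hv.1 hv.2
    rw [iteratedDeriv_succ, Filter.EventuallyEq.deriv_eq hnhds]
    -- differentiate the combination
    have hder : HasDerivAt (fun v : ℂ => ∑ i : J, (z i : ℂ) • ((ℓ i).map fun o : Option ℕ => o.elim (Φ (D + v • P)⁻¹)⁻¹ (fun j => Φ ((D + v • P)⁻¹ * (P * (D + v • P)⁻¹) ^ j))).prod)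
        (∑ i : J, (z i : ℂ) • ∑ i' : Jf i, (zf i i' : ℂ) •
          ((ℓf i i').map fun o : Option ℕ => o.elim (Φ (D + u • P)⁻¹)⁻¹ (fun j => Φ ((D + u • P)⁻¹ * (P * (D + u • P)⁻¹) ^ j))).prod) u :=
      HasDerivAt.fun_sum fun i _ => (hf i D P Φ u hu hc).fun_const_smul (z i : ℂ)
    rw [hder.deriv, Fintype.sum_sigma]
    refine Finset.sum_congr rfl fun i _ => ?_
    rw [Finset.smul_sum]
    refine Finset.sum_congr rfl fun i' _ => ?_
    rw [smul_smul, Int.cast_mul]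

end Diagrams

/-! ## §3 The first-order model: every u-derivative of `(c_k(u))⁻¹` at `u = 0` on `ℤ^d`, modulo only the background's pointwise limit -/

section Model

open Literature.MathematicalPhysics.QuantumFieldTheory.Balaban1983to89
open Literature.MathematicalPhysics.QuantumFieldTheory.Balaban1983to89.B5G183RateUnitTower (lev)
open Literature.MathematicalPhysics.QuantumFieldTheory.Balaban1983to89.B12Sec2to5 (betaPrime510)
open Literature.MathematicalPhysics.QuantumFieldTheory.Balaban1983to89.Beta (Site IsInfiniteVolumeLimit)
open Literature.MathematicalPhysics.QuantumFieldTheory.Balaban1983to89.Beta.FreeLegDictionary (cubic)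
open Literature.MathematicalPhysics.QuantumFieldTheory.Balaban1983to89.Beta.BlockKernelVolumeSockets (evenPeriod)
open Literature.MathematicalPhysics.QuantumFieldTheory.Balaban1983to89.Beta.VectorTails (castT)
open Literature.MathematicalPhysics.QuantumFieldTheory.Balaban1983to89.Beta.LimitRate (StepRate limKernelOf KernelInputs)
open Summit.QuantumFields.BalabanUV.T4Continuum
open Summit.QuantumFields.BalabanUV.T4Continuum.CovariantAveragingTower (Atow avgTow)
open Summit.QuantumFields.BalabanUV.T4Continuum.BalabanAveragedTowerUnit (idx QBlev calGlev unitCovB)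
open Summit.QuantumFields.BalabanUV.T4Continuum.BalabanAveragedCoerciveTower (unitIdx)
open Summit.QuantumFields.BalabanUV.T4Continuum.KingPairingPlantedLaw (calDalev calDalev_inv isUnit_det_calDalev)
open Summit.QuantumFields.BalabanUV.T4Continuum.FirstOrderBackgroundModel (LipschitzBackground Pmodel)
open Summit.QuantumFields.BalabanUV.Beta.GAN24.EffectiveFormInsertionLaw (isUnit_det_unitCovB_and_opNorm_inv_le)
open Summit.QuantumFields.BalabanUV.Beta.GAN24.BackgroundExpansionAllOrders (conv_diagramSum_of_tendsto_background)

/-- `G(PG)^j` is PART 122 ∕ 159's constant word of length `j`: `foldr (fun _ N ↦ G·P·N) G (replicate j ⋆)`. [folklore] -/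
theorem chainPow_eq_word {ι : Type*} [Fintype ι] [DecidableEq ι] (G P : Matrix ι ι ℂ) (j : ℕ) :
    G * (P * G) ^ j = List.foldr (fun (_ : Unit) N => G * P * N) G (List.replicate j ()) := by
  induction j with
  | zero => rw [pow_zero, Matrix.mul_one, List.replicate_zero, List.foldr_nil]
  | succ j ih => rw [List.replicate_succ, List.foldr_cons, ← ih, pow_succ']; simp only [Matrix.mul_assoc]

/-- the level-`k` averaging `X ↦ r^k·A^{(k)}X_kA^{(k)ᴴ}` of a tower (`avgTow A r X k`) reads ONLY `X_k` and is a continuous linear read-out of it. [folklore] -/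
theorem exists_clm_avgTow {ι : ℕ → Type} [∀ k, Fintype (ι k)] [∀ k, DecidableEq (ι k)] (A : (k : ℕ) → Matrix (ι k) (ι (k + 1)) ℂ) (r : ℝ) (k : ℕ) :
    ∃ Φ : Matrix (ι k) (ι k) ℂ →L[ℂ] Matrix (ι 0) (ι 0) ℂ, ∀ X : (k : ℕ) → Matrix (ι k) (ι k) ℂ, avgTow A r X k = Φ (X k) := by
  refine ⟨LinearMap.toContinuousLinearMap
    { toFun := fun Y => ((r : ℂ) ^ k) • (Atow A k * Y * (Atow A k)ᴴ)
      map_add' := fun Y Z => by simp only [Matrix.mul_add, Matrix.add_mul, smul_add]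
      map_smul' := fun c Y => by simp only [Matrix.mul_smul, Matrix.smul_mul, RingHom.id_apply, smul_comm c] }, fun X => rfl⟩

variable {d : ℕ} (L : ℕ) [NeZero L] (a : ℝ) (ha : 0 < a)

/-- **`conv_iteratedDeriv_invPertCov_of_tendsto_background` — EVERY u-DERIVATIVE OF `(c_k(u))⁻¹` AT `u = 0` ON `ℤ^d`, MODULO ONLY THE BACKGROUND's POINTWISE LIMIT** [our proof]
(`d ≥ 3`, `L ≥ 2`, `a > 0`, `μ ≠ ν`, even cubic volumes `2(t+1)`, every order `N`; a volume-indexed family of Lipschitz backgrounds `V_t` with `(α, β)` uniform DISPLAYING ONLY EL₁):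
the tower family `(t, k) ↦ ∂^N_u[(L^{dk}Q_k(Δ_a^{(k)} + uP(V_t)^{(k)})⁻¹Q_kᴴ)⁻¹]|_{u=0}` has `∃ κ > 0, B, B′ ≥ 0, Π` with `IsInfiniteVolumeLimit`, `UniformDecay Π μ ν B (κ∕d)`,
`StepRate Π μ ν B′ (κ∕d) (√(L⁻¹))`, `KernelInputs d Π`, `∀ k, |secondMoment (Π k) μ ν − secondMoment (limKernelOf Π) μ ν| ≤ β′_d(B′∕(1−√(L⁻¹)), κ∕d)·(√(L⁻¹))^k` — §2's uniform
Faà di Bruno identity at `u = 0` (letters `c_k⁻¹` and the constant words `X^{(j)}_k` of one background) + PART 160's END for finite `ℤ`-combinations of diagrams.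
[cite: Balaban1987RG1, (1.21)–(1.22) p.264 (shapes)] -/
theorem conv_iteratedDeriv_invPertCov_of_tendsto_background (hL : 2 ≤ L) (hd : 3 ≤ d) {μ ν : Fin d} (hne : μ ≠ ν) {α β : ℝ}
    {V : (t : ℕ) → (k : ℕ) → Fin d → (idx L (cubic d (evenPeriod t)) k → ℂ)} (hV : ∀ t, LipschitzBackground L (cubic d (evenPeriod t)) (V t) α β)
    (hV1 : ∀ k (μ f : Fin d) (z : Fin d → ℤ), ∃ s : ℂ, Tendsto (fun t => V t k μ (castT (cubic d (lev L k * evenPeriod t)) z, f)) atTop (𝓝 s)) (N : ℕ) :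
    ∃ κ B B' : ℝ, 0 < κ ∧ 0 ≤ B ∧ 0 ≤ B' ∧ ∃ Pinf : ℕ → B12Beta.Kernel d,
      (∀ k, IsInfiniteVolumeLimit evenPeriod
        (fun t μ' ν' (z : Site d (evenPeriod t)) =>
          ((iteratedDeriv N (fun u : ℂ => (avgTow (QBlev L (cubic d (evenPeriod t))) ((L : ℝ) ^ d)
              (fun k' => (calDalev L (cubic d (evenPeriod t)) a ha k' + u • Pmodel L (cubic d (evenPeriod t)) (V t) k')⁻¹) k)⁻¹) 0)
            ((unitIdx L (cubic d (evenPeriod t))).symm (z, μ')) ((unitIdx L (cubic d (evenPeriod t))).symm (0, ν'))).re) (Pinf k)) ∧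
      Beta.LimitRate.UniformDecay Pinf μ ν B (κ / d) ∧ StepRate Pinf μ ν B' (κ / d) (Real.sqrt ((L : ℝ)⁻¹)) ∧
      (∃ K : KernelInputs d Pinf, K.θ = Real.sqrt ((L : ℝ)⁻¹) ∧ K.c₀ = betaPrime510 d (B' / (1 - Real.sqrt ((L : ℝ)⁻¹))) (κ / d) ∧ K.Pinf = limKernelOf Pinf ∧ K.μ = μ ∧ K.ν = ν) ∧
      (∀ k, |B12Beta.secondMoment (Pinf k) μ ν - B12Beta.secondMoment (limKernelOf Pinf) μ ν|
          ≤ betaPrime510 d (B' / (1 - Real.sqrt ((L : ℝ)⁻¹))) (κ / d) * Real.sqrt ((L : ℝ)⁻¹) ^ k) := by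
  obtain ⟨J, hJ, z, ℓ, hN⟩ := iteratedDeriv_inv_eq_diagramSum N
  -- PART 160's END for the combination `Σ_i z_i • diagram((ℓ i).map (Option.map replicate))` over the one-letter alphabet `Unit`
  obtain ⟨κ, B, B', hκ, hB, hB', Pinf, hIVL, hUD, hSR, hK, hsm⟩ :=
    conv_diagramSum_of_tendsto_background L a ha (σ := Unit) (V := fun _ => V) hL hd hne (fun _ t => hV t) (fun _ k => hV1 k)
      Finset.univ (fun i => (z i : ℂ)) (fun i => (ℓ i).map (Option.map fun j => List.replicate j ()))
  refine ⟨κ, B, B', hκ, hB, hB', Pinf, fun k => ?_, hUD, hSR, hK, hsm⟩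
  -- the identity at `u = 0`, volume by volume
  have key : ∀ t, iteratedDeriv N (fun u : ℂ => (avgTow (QBlev L (cubic d (evenPeriod t))) ((L : ℝ) ^ d)
        (fun k' => (calDalev L (cubic d (evenPeriod t)) a ha k' + u • Pmodel L (cubic d (evenPeriod t)) (V t) k')⁻¹) k)⁻¹) 0
      = (∑ i ∈ Finset.univ, (fun i => (z i : ℂ)) i • ((((ℓ i).map (Option.map fun j => List.replicate j ())).map fun o => o.elim
          (fun t k => (unitCovB L (cubic d (evenPeriod t)) a ha k)⁻¹)
          (fun w t k => avgTow (QBlev L (cubic d (evenPeriod t))) ((L : ℝ) ^ d)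
            (fun k' => List.foldr (fun i N => calGlev L (cubic d (evenPeriod t)) a ha k' * Pmodel L (cubic d (evenPeriod t)) ((fun _ : Unit => V) i t) k' * N)
              (calGlev L (cubic d (evenPeriod t)) a ha k') w) k)).prod)) t k := by
    intro t
    set M := cubic d (evenPeriod t) with hM
    obtain ⟨Φ, hΦ⟩ := exists_clm_avgTow (QBlev L M) ((L : ℝ) ^ d) k
    set D : Matrix (idx L M k) (idx L M k) ℂ := calDalev L M a ha k with hD
    set P : Matrix (idx L M k) (idx L M k) ℂ := Pmodel L M (V t) k with hP
    have hF : (fun u : ℂ => (avgTow (QBlev L M) ((L : ℝ) ^ d) (fun k' => (calDalev L M a ha k' + u • Pmodel L M (V t) k')⁻¹) k)⁻¹)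
        = fun u : ℂ => (Φ (D + u • P)⁻¹)⁻¹ := by
      funext u; rw [hΦ]
    have ec : Φ D⁻¹ = unitCovB L M a ha k := by
      rw [hD, calDalev_inv]
      exact (hΦ (calGlev L M a ha)).symm
    have h0 : IsUnit (D + (0 : ℂ) • P).det := by rw [zero_smul, add_zero]; exact isUnit_det_calDalev L M a ha k
    have hc0 : IsUnit (Φ (D + (0 : ℂ) • P)⁻¹).det := by rw [zero_smul, add_zero, ec]; exact (isUnit_det_unitCovB_and_opNorm_inv_le L M a ha k).1
    rw [hF, hN D P Φ 0 h0 hc0, Finset.sum_apply, Finset.sum_apply]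
    refine Finset.sum_congr rfl fun i _ => ?_
    rw [Pi.smul_apply, Pi.smul_apply, Pi.list_prod_apply, Pi.list_prod_apply, List.map_map, List.map_map, List.map_map]
    congr 1
    refine congrArg List.prod (List.map_congr_left fun o _ => ?_)
    cases o with
    | none =>
      simp only [Function.comp_apply, Option.map_none, Option.elim, zero_smul, add_zero, ec]
      rfl
    | some j =>
      simp only [Function.comp_apply, Option.map_some, Option.elim, zero_smul, add_zero]
      rw [hΦ, hD, calDalev_inv, chainPow_eq_word]
  have e : (fun t μ' ν' (x : Site d (evenPeriod t)) =>
      ((iteratedDeriv N (fun u : ℂ => (avgTow (QBlev L (cubic d (evenPeriod t))) ((L : ℝ) ^ d)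
          (fun k' => (calDalev L (cubic d (evenPeriod t)) a ha k' + u • Pmodel L (cubic d (evenPeriod t)) (V t) k')⁻¹) k)⁻¹) 0)
        ((unitIdx L (cubic d (evenPeriod t))).symm (x, μ')) ((unitIdx L (cubic d (evenPeriod t))).symm (0, ν'))).re)
      = fun t μ' ν' (x : Site d (evenPeriod t)) =>
      (((∑ i ∈ Finset.univ, (fun i => (z i : ℂ)) i • ((((ℓ i).map (Option.map fun j => List.replicate j ())).map fun o => o.elim
          (fun t k => (unitCovB L (cubic d (evenPeriod t)) a ha k)⁻¹)
          (fun w t k => avgTow (QBlev L (cubic d (evenPeriod t))) ((L : ℝ) ^ d)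
            (fun k' => List.foldr (fun i N => calGlev L (cubic d (evenPeriod t)) a ha k' * Pmodel L (cubic d (evenPeriod t)) ((fun _ : Unit => V) i t) k' * N)
              (calGlev L (cubic d (evenPeriod t)) a ha k') w) k)).prod)) t k)
        ((unitIdx L (cubic d (evenPeriod t))).symm (x, μ')) ((unitIdx L (cubic d (evenPeriod t))).symm (0, ν'))).re := by
    funext t μ' ν' x
    rw [key t]
  rw [e]
  exact hIVL k

/-- **`conv_iteratedDeriv_effFormPert_of_tendsto_background` — EVERY u-DERIVATIVE OF THE EFFECTIVE FORM WITH BACKGROUND `Σ_k(u) = c_k(u)⁻¹ − a″1` AT `u = 0`, ORDER `N ≥ 1`, ON `ℤ^d`**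
[our proof]: `∂^N_uΣ_k(u)|₀ = ∂^N_u(c_k(u)⁻¹)|₀` (`iteratedDeriv_const_add`), then `conv_iteratedDeriv_invPertCov_of_tendsto_background`.  PART 147 is `N = 1`, PART 157 is `N = 2`
(up to the identification of the diagrams, PART 121); `N = 0` is PART 152 at `u = 0` ∕ PART 139. [cite: Balaban1987RG1, (1.21)–(1.22) p.264 (shapes)] -/
theorem conv_iteratedDeriv_effFormPert_of_tendsto_background (hL : 2 ≤ L) (hd : 3 ≤ d) {μ ν : Fin d} (hne : μ ≠ ν) {α β : ℝ}
    {V : (t : ℕ) → (k : ℕ) → Fin d → (idx L (cubic d (evenPeriod t)) k → ℂ)} (hV : ∀ t, LipschitzBackground L (cubic d (evenPeriod t)) (V t) α β)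
    (hV1 : ∀ k (μ f : Fin d) (z : Fin d → ℤ), ∃ s : ℂ, Tendsto (fun t => V t k μ (castT (cubic d (lev L k * evenPeriod t)) z, f)) atTop (𝓝 s)) {N : ℕ} (hN : 0 < N)
    (a'' : ℂ) :
    ∃ κ B B' : ℝ, 0 < κ ∧ 0 ≤ B ∧ 0 ≤ B' ∧ ∃ Pinf : ℕ → B12Beta.Kernel d,
      (∀ k, IsInfiniteVolumeLimit evenPeriod
        (fun t μ' ν' (z : Site d (evenPeriod t)) =>
          ((iteratedDeriv N (fun u : ℂ => (avgTow (QBlev L (cubic d (evenPeriod t))) ((L : ℝ) ^ d)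
              (fun k' => (calDalev L (cubic d (evenPeriod t)) a ha k' + u • Pmodel L (cubic d (evenPeriod t)) (V t) k')⁻¹) k)⁻¹
              - a'' • (1 : Matrix (idx L (cubic d (evenPeriod t)) 0) (idx L (cubic d (evenPeriod t)) 0) ℂ)) 0)
            ((unitIdx L (cubic d (evenPeriod t))).symm (z, μ')) ((unitIdx L (cubic d (evenPeriod t))).symm (0, ν'))).re) (Pinf k)) ∧
      Beta.LimitRate.UniformDecay Pinf μ ν B (κ / d) ∧ StepRate Pinf μ ν B' (κ / d) (Real.sqrt ((L : ℝ)⁻¹)) ∧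
      (∃ K : KernelInputs d Pinf, K.θ = Real.sqrt ((L : ℝ)⁻¹) ∧ K.c₀ = betaPrime510 d (B' / (1 - Real.sqrt ((L : ℝ)⁻¹))) (κ / d) ∧ K.Pinf = limKernelOf Pinf ∧ K.μ = μ ∧ K.ν = ν) ∧
      (∀ k, |B12Beta.secondMoment (Pinf k) μ ν - B12Beta.secondMoment (limKernelOf Pinf) μ ν|
          ≤ betaPrime510 d (B' / (1 - Real.sqrt ((L : ℝ)⁻¹))) (κ / d) * Real.sqrt ((L : ℝ)⁻¹) ^ k) := by
  have e : ∀ t k, iteratedDeriv N (fun u : ℂ => (avgTow (QBlev L (cubic d (evenPeriod t))) ((L : ℝ) ^ d)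
        (fun k' => (calDalev L (cubic d (evenPeriod t)) a ha k' + u • Pmodel L (cubic d (evenPeriod t)) (V t) k')⁻¹) k)⁻¹
        - a'' • (1 : Matrix (idx L (cubic d (evenPeriod t)) 0) (idx L (cubic d (evenPeriod t)) 0) ℂ)) 0
      = iteratedDeriv N (fun u : ℂ => (avgTow (QBlev L (cubic d (evenPeriod t))) ((L : ℝ) ^ d)
        (fun k' => (calDalev L (cubic d (evenPeriod t)) a ha k' + u • Pmodel L (cubic d (evenPeriod t)) (V t) k')⁻¹) k)⁻¹) 0 := by
    intro t k
    have h := iteratedDeriv_const_add (𝕜 := ℂ) (x := (0 : ℂ)) hN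
      (-(a'' • (1 : Matrix (idx L (cubic d (evenPeriod t)) 0) (idx L (cubic d (evenPeriod t)) 0) ℂ)))
      (f := fun u : ℂ => (avgTow (QBlev L (cubic d (evenPeriod t))) ((L : ℝ) ^ d)
        (fun k' => (calDalev L (cubic d (evenPeriod t)) a ha k' + u • Pmodel L (cubic d (evenPeriod t)) (V t) k')⁻¹) k)⁻¹)
    simp only [neg_add_eq_sub] at h
    exact h
  simp only [e]
  exact conv_iteratedDeriv_invPertCov_of_tendsto_background L a ha hL hd hne hV hV1 N

end Model

end Summit.QuantumFields.BalabanUV.Beta.GAN24.BackgroundExpansionTaylor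

end
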